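import Mathlib
import HarnessLib
import Summits.AtomisticToContinuum.FouriersLaw.Theses.JunctionLocality
import Literature.MathematicalPhysics.KineticTheory.LangevinChainGibbs
import Summits.AtomisticToContinuum.FouriersLaw.Theorems.JunctionLocalitySuperadditiveResistanceDeviceEnergy

/-!
# The γ-probed device at equilibrium, V: propagation, the `L²(μ_T)`-Liouville theorem, forward fields

Part V (final) of the helper development (`--supports` stmt-AtomisticToContinuum-11748) for the line
`thermalise-then-cut-probe-insertion` of the crux `JunctionLocality.SuperadditiveResistance`, stub
`stub_linearResponse`. The line inserts two Langevin thermostats of the chain's own strength `γ`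
on the junction momenta `p_{N−1}, p_N` of the `(N+M)`-site chain `pinnedChain ω₂ lam β γ` (the
DEVICE, generator `deviceGenerator`, Part I). Its stub asks (`DeviceFrame`) for weak device steady
states and for existence AND uniqueness of the equilibrium forward fields
`gb = (−L_dev)⁻¹(p_s² − T)` as classical `C²` solutions in `L²(μ_T)`. The five files prove,
unconditionally (axioms `propext`, `Classical.choice`, `Quot.sound`):

* Part I `pinnedChain_isDeviceSteadyState_gibbsMeasure`: at equal terminal temperatures the Gibbs
  state is a weak steady state of the device (DeviceFrame (i) at `τ ≡ T`, anchor of (v)).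
* Part IV `partialP_eq_zero_of_genOp_eq_zero` (energy step) and, here,
  `fderiv_eq_zero_of_liouville` (propagation) ⇒ `liouville_pinnedChain`:
  **`L²(μ_T)`-Liouville theorem** — for `ω₂ > 0`, `lam, β ≥ 0`, `T > 0`, site weights `B ≥ 0`
  charging site `0`, `σ ≠ 0`, `c > 0`, every `w ∈ C² ∩ L²(μ_T)` with `σ X_H w + c S_B w = 0`
  pointwise (`X_H = liouvilleOp`, `S_B = bathOp`, Part II) is constant. Energy step: test the
  `μ_T`-conservativity of `σ X_H + c S_B` against `φ(H/n) w²` (Parts II–III) — the carré du champ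
  is `≤ ∫ w²|S_B φ(H/n)| + O(1/n)∫w² → 0`, so `∂_{p_j} w ≡ 0` wherever `B_j > 0`. Propagation:
  then `S_B w = 0` and `Dw · X_H ≡ 0`; differentiating this transport identity alternately along
  `∂_{p_k}`, `∂_{q_k}` (symmetry of `D²w`, `w ∈ C²`) walks `Dw = 0` down the chain through the
  sub-diagonal Hessian entries `−V″(q_{k+1} − q_k) ≠ 0` (`V″ = 1 + 3βr²`) — Hörmander's bracket
  mechanism at the level of first integrals. No semigroup, no hypoellipticity, no growth
  condition on `∇w`.
* `forwardField_unique`: two forward fields of the same terminal observable coincide (the clauses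
  `∀ gb, IsForwardField P T N M s gb → gb = gb₁` of the line's `DeviceFrame`, hypotheses of
  `IsForwardField` spelled out; `eq_zero_of_liouville_pinnedChain` is the mean-zero form). With
  `σ = −1` (`L_T^† = −X_H + γS`) the Liouville theorem is also the classical half of the uniqueness
  clause of the line's `PlainFrame`; the other half (hypoelliptic regularity of `L²` weak
  solutions, Hörmander's theorem in the tree) is not done here.

Mechanism: Eckmann–Pillet–Rey-Bellet, CMP 201 (1999) §3; Villani, *Hypocoercivity* (2009). Nothing is
taken as a named fact.
-/

noncomputable section

open MeasureTheory Filter Topology ProbabilityTheory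
open scoped ContDiff NNReal
open Literature.MathematicalPhysics.KineticTheory.HeatConduction

namespace Summit.AtomisticToContinuum.FouriersLaw.Theorems.SuperadditiveResistance.DeviceLiouville

/-! ## Propagation along the chain (the Hörmander bracket mechanism, at the level of `Dw`) -/

section Propagation

variable (P : OscillatorChain) {L : ℕ}

/-- The Hamiltonian vector field `X_H(q,p) = (p, −∇Φ(q))`. [folklore] -/
def hamField (L : ℕ) (x : PhaseSpace L) : PhaseSpace L :=
  (x.2, fun i => -P.dPotential L i x.1)

/-- `X_H` is smooth for smooth potentials. (adapted from `OscillatorChain.contDiff_drift`) [folklore] -/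
theorem contDiff_hamField (hU : ContDiff ℝ ∞ P.U) (hV : ContDiff ℝ ∞ P.V) (L : ℕ) :
    ContDiff ℝ ∞ (hamField P L) :=
  contDiff_snd.prodMk (contDiff_pi.2 fun i =>
    ((P.contDiff_dPotential hU hV L i).comp contDiff_fst).neg)

/-- `∂X_H/∂p_j = (e_j, 0)`. (adapted from `OscillatorChain.hasLineDerivAt_drift_unitP`) [folklore] -/
theorem hasLineDerivAt_hamField_unitP (L : ℕ) (x : PhaseSpace L) (j : Fin L) :
    HasLineDerivAt ℝ (hamField P L) (unitQ j) x (unitP j) := by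
  unfold HasLineDerivAt hamField
  simp only [unitP_eq, unitQ_eq, add_smul_unitP_fst, add_smul_unitP_snd]
  have hlin : HasDerivAt (fun t : ℝ => x.2 + t • (Pi.single j (1 : ℝ) : Fin L → ℝ))
      (Pi.single j 1) 0 := by
    simpa using ((hasDerivAt_id (0 : ℝ)).smul_const (Pi.single j (1 : ℝ) : Fin L → ℝ)).const_add
      x.2
  exact hlin.prodMk (hasDerivAt_const _ _)

/-- `∂X_H/∂q_j = (0, -(∂²Φ/∂q_j∂q_i)_i)`. (adapted from `OscillatorChain.hasLineDerivAt_drift_unitQ`) [folklore] -/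
theorem hasLineDerivAt_hamField_unitQ (hU : ContDiff ℝ ∞ P.U) (hV : ContDiff ℝ ∞ P.V) (L : ℕ)
    (x : PhaseSpace L) (j : Fin L) :
    HasLineDerivAt ℝ (hamField P L) ((0, fun i => -P.hessPotential L i j x.1) : PhaseSpace L)
      x (unitQ j) := by
  unfold HasLineDerivAt hamField
  simp only [unitQ_eq, add_smul_unitQ_fst, add_smul_unitQ_snd]
  refine (hasDerivAt_const (0 : ℝ) x.2).prodMk (hasDerivAt_pi.2 fun i => ?_)
  have hU' : ContDiff ℝ ∞ (deriv P.U) := hU.deriv'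
  have hV' : ContDiff ℝ ∞ (deriv P.V) := hV.deriv'
  have hU2 : Differentiable ℝ (deriv P.U) := hU'.differentiable (by simp)
  have hV2 : Differentiable ℝ (deriv P.V) := hV'.differentiable (by simp)
  exact (P.hasDerivAt_dPotential_add_smul hU2 hV2 L x.1 i j).neg

/-- `DX_H(x)(0,e_j) = (e_j,0)`. [folklore] -/
theorem fderiv_hamField_unitP (hU : ContDiff ℝ ∞ P.U) (hV : ContDiff ℝ ∞ P.V) (L : ℕ)
    (x : PhaseSpace L) (j : Fin L) : fderiv ℝ (hamField P L) x (unitP j) = unitQ j := by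
  have hd : DifferentiableAt ℝ (hamField P L) x :=
    ((contDiff_hamField P hU hV L).differentiable (by simp)) x
  rw [← hd.lineDeriv_eq_fderiv]
  exact (hasLineDerivAt_hamField_unitP P L x j).lineDeriv

/-- `DX_H(x)(e_j,0) = (0, -(Hess Φ)_{·j})`. [folklore] -/
theorem fderiv_hamField_unitQ (hU : ContDiff ℝ ∞ P.U) (hV : ContDiff ℝ ∞ P.V) (L : ℕ)
    (x : PhaseSpace L) (j : Fin L) :
    fderiv ℝ (hamField P L) x (unitQ j) = ((0, fun i => -P.hessPotential L i j x.1) : PhaseSpace L) := by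
  have hd : DifferentiableAt ℝ (hamField P L) x :=
    ((contDiff_hamField P hU hV L).differentiable (by simp)) x
  rw [← hd.lineDeriv_eq_fderiv]
  exact (hasLineDerivAt_hamField_unitQ P hU hV L x j).lineDeriv

/-- The Liouville operator is `Dw · X_H`. (adapted from `OscillatorChain.generator_eq_fderiv_drift_add`) [folklore] -/
theorem liouvilleOp_eq_fderiv (hU : Differentiable ℝ P.U) (hV : Differentiable ℝ P.V)
    {f : PhaseSpace L → ℝ} (hf : Differentiable ℝ f) (x : PhaseSpace L) :
    liouvilleOp P L f x = fderiv ℝ f x (hamField P L x) := by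
  rw [clm_apply_eq_sum]
  simp only [liouvilleOp, hamField, partialQ_eq_fderiv hf, partialP_eq_fderiv hf,
    P.partialQ_hamiltonian_eq_dPotential hU hV, smul_eq_mul, unitQ_eq, unitP_eq,
    ← Finset.sum_add_distrib]
  refine Finset.sum_congr rfl fun i _ => ?_
  ring

variable {P}

/-- If `Dw(·) u ≡ 0` for a fixed vector `u` and `w ∈ C²`, then `D²w(x)(u, v) = 0` for all `v`
(symmetry of the second derivative). [folklore] -/
theorem fderiv_fderiv_apply_eq_zero {w : PhaseSpace L → ℝ} (hw : ContDiff ℝ 2 w)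
    {u : PhaseSpace L} (hu : ∀ x, fderiv ℝ w x u = 0) (x v : PhaseSpace L) :
    fderiv ℝ (fderiv ℝ w) x u v = 0 := by
  have hsymm : IsSymmSndFDerivAt ℝ w x :=
    (hw.contDiffAt (x := x)).isSymmSndFDerivAt (by simp)
  rw [hsymm u v]
  have hd : DifferentiableAt ℝ (fderiv ℝ w) x :=
    ((hw.fderiv_right (m := 1) (by norm_num)).differentiable one_ne_zero) x
  have h2 : fderiv ℝ (fun y => fderiv ℝ w y u) x v = fderiv ℝ (fderiv ℝ w) x v u := by
    rw [fderiv_clm_apply hd (differentiableAt_const u)]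
    simp
  have h1 : fderiv ℝ (fun y => fderiv ℝ w y u) x = 0 := by
    have : (fun y => fderiv ℝ w y u) = fun _ => (0 : ℝ) := funext hu
    rw [this]
    simp
  rw [← h2, h1]
  rfl

/-- Differentiating the transport identity `Dw · F ≡ 0` along a direction `u` with `Dw(·) u ≡ 0`
gives `Dw (DF u) ≡ 0` (the commutator `[u, F]` direction). [folklore] -/
theorem fderiv_apply_fderiv_field_eq_zero {w : PhaseSpace L → ℝ} (hw : ContDiff ℝ 2 w)
    {F : PhaseSpace L → PhaseSpace L} (hF : Differentiable ℝ F)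
    (hg : ∀ x, fderiv ℝ w x (F x) = 0) {u : PhaseSpace L} (hu : ∀ x, fderiv ℝ w x u = 0)
    (x : PhaseSpace L) : fderiv ℝ w x (fderiv ℝ F x u) = 0 := by
  have hc : DifferentiableAt ℝ (fderiv ℝ w) x :=
    ((hw.fderiv_right (m := 1) (by norm_num)).differentiable one_ne_zero) x
  have h := fderiv_clm_apply hc (hF x)
  have h0 : fderiv ℝ (fun y => fderiv ℝ w y (F y)) x = 0 := by
    have : (fun y => fderiv ℝ w y (F y)) = fun _ => (0 : ℝ) := funext hg
    rw [this]
    simp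
  have h3 := congrArg (fun φ : PhaseSpace L →L[ℝ] ℝ => φ u) h
  simp only [h0, zero_apply, add_apply, ContinuousLinearMap.coe_comp, Function.comp_apply,
    ContinuousLinearMap.flip_apply] at h3
  rw [fderiv_fderiv_apply_eq_zero hw hu x (F x), add_zero] at h3
  exact h3.symm

/-- **Propagation.** For a chain whose interaction has `V'' ≠ 0` everywhere: if `w ∈ C²` is a first
integral of `X_H` (`Dw · X_H ≡ 0`) which does not depend on `p_0`, then `Dw ≡ 0` — the
controllability of the chain from its first momentum (Hörmander's bracket condition, realised by
differentiating the transport equation alternately along `∂_{p_k}` and `∂_{q_k}`). [folklore] -/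
theorem fderiv_eq_zero_of_liouville (hU : ContDiff ℝ ∞ P.U) (hV : ContDiff ℝ ∞ P.V)
    (hV2 : ∀ r, deriv (deriv P.V) r ≠ 0) (hL : 0 < L) {w : PhaseSpace L → ℝ} (hw : ContDiff ℝ 2 w)
    (hX : ∀ x, fderiv ℝ w x (hamField P L x) = 0)
    (h0 : ∀ x, fderiv ℝ w x (unitP ⟨0, hL⟩) = 0) (x : PhaseSpace L) : fderiv ℝ w x = 0 := by
  have hFd : Differentiable ℝ (hamField P L) := (contDiff_hamField P hU hV L).differentiable (by simp)
  -- B1: independence of p_k ⇒ independence of q_k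
  have B1 : ∀ k : Fin L, (∀ y, fderiv ℝ w y (unitP k) = 0) → ∀ y, fderiv ℝ w y (unitQ k) = 0 := by
    intro k hk y
    have := fderiv_apply_fderiv_field_eq_zero hw hFd hX hk y
    rwa [fderiv_hamField_unitP P hU hV L y k] at this
  -- B2: independence of (q_j, p_j), j ≤ k ⇒ independence of p_{k+1}
  have B2 : ∀ k : Fin L, (∀ j : Fin L, j.val ≤ k.val → ∀ y, fderiv ℝ w y (unitP j) = 0) →
      (∀ y, fderiv ℝ w y (unitQ k) = 0) →
      ∀ k' : Fin L, k'.val = k.val + 1 → ∀ y, fderiv ℝ w y (unitP k') = 0 := by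
    intro k hPk hQk k' hk' y
    have h := fderiv_apply_fderiv_field_eq_zero hw hFd hX hQk y
    rw [fderiv_hamField_unitQ P hU hV L y k, clm_apply_eq_sum] at h
    simp only [Pi.zero_apply, smul_eq_mul, zero_mul, Finset.sum_const_zero, zero_add] at h
    -- only i = k' survives
    rw [Finset.sum_eq_single_of_mem k' (Finset.mem_univ _)] at h
    · rw [P.hessPotential_succ L hk', neg_neg] at h
      rcases mul_eq_zero.mp h with h1 | h1
      · exact absurd h1 (hV2 _)
      · exact h1
    · intro i _ hi
      by_cases hik : i.val ≤ k.val
      · rw [hPk i hik y, mul_zero]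
      · have : k.val + 2 ≤ i.val := by
          have h1 : i.val ≠ k'.val := fun e => hi (Fin.ext e)
          omega
        rw [P.hessPotential_eq_zero_of_le L this, neg_zero, zero_mul]
  -- induction on the site index
  have main : ∀ n : ℕ, ∀ j : Fin L, j.val ≤ n →
      (∀ y, fderiv ℝ w y (unitP j) = 0) ∧ (∀ y, fderiv ℝ w y (unitQ j) = 0) := by
    intro n
    induction n with
    | zero =>
      intro j hj
      have hj0 : j = ⟨0, hL⟩ := Fin.ext (Nat.le_zero.mp hj)
      subst hj0
      exact ⟨h0, B1 _ h0⟩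
    | succ n ih =>
      intro j hj
      by_cases hjn : j.val ≤ n
      · exact ih j hjn
      · have hjeq : j.val = n + 1 := by omega
        have hnL : n < L := by omega
        have hP : ∀ y, fderiv ℝ w y (unitP j) = 0 :=
          B2 ⟨n, hnL⟩ (fun j' hj' => (ih j' hj').1) (ih ⟨n, hnL⟩ le_rfl).2 j hjeq
        exact ⟨hP, B1 j hP⟩
  refine ContinuousLinearMap.ext fun v => ?_
  rw [clm_apply_eq_sum]
  simp [fun i : Fin L => (main i.val i le_rfl).1, fun i : Fin L => (main i.val i le_rfl).2]

end Propagation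

/-! ## The Liouville theorem and uniqueness of forward fields -/

section Liouville

variable {ω₂ lam β : ℝ}

/-- **`L²(μ_T)`-Liouville theorem for the thermostatted pinned chain.** For
`pinnedChain ω₂ lam β γ` (`ω₂ > 0`, `lam, β ≥ 0`), `T > 0`, non-negative site weights `B` charging
site `0`, `σ ≠ 0`, `c > 0`: a `C²` function `w ∈ L²(μ_T)` with `σ X_H w + c S_B w = 0` pointwise
is constant. (Energy step: `∂_{p_b} w = 0` at the weighted sites, so `S_B w = 0` and `X_H w = 0`;
propagation from `p_0` through `V'' = 1 + 3βr² > 0`: `Dw = 0`.) [folklore] -/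
theorem liouville_pinnedChain (hω : 0 < ω₂) (hl : 0 ≤ lam) (hβ : 0 ≤ β) (γ : ℝ) {L : ℕ}
    (hL : 0 < L) {T : ℝ} (hT : 0 < T) (B : Fin L → ℝ) (hB : ∀ i, 0 ≤ B i) (hB0 : 0 < B ⟨0, hL⟩)
    {σ : ℝ} (hσ : σ ≠ 0) {c : ℝ} (hc : 0 < c) {w : PhaseSpace L → ℝ} (hw : ContDiff ℝ 2 w)
    (hw2 : MemLp w 2 ((pinnedChain ω₂ lam β γ).gibbsMeasure L T))
    (hpde : ∀ x, σ * liouvilleOp (pinnedChain ω₂ lam β γ) L w x + c * bathOp L B T w x = 0)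
    (x y : PhaseSpace L) : w x = w y := by
  have hU : ContDiff ℝ ∞ (pinnedChain ω₂ lam β γ).U := pinnedChain_contDiff_U ω₂ lam β γ
  have hV : ContDiff ℝ ∞ (pinnedChain ω₂ lam β γ).V := pinnedChain_contDiff_V ω₂ lam β γ
  have hwd : Differentiable ℝ w := hw.differentiable two_ne_zero
  have hA : ∀ i, 0 < B i → ∀ z, partialP i w z = 0 := fun i hi z =>
    partialP_eq_zero_of_genOp_eq_zero hω hl hβ γ L hT B hB σ hc hw hw2 hpde hi z
  have hbath : ∀ z, bathOp L B T w z = 0 := by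
    intro z
    unfold bathOp
    refine Finset.sum_eq_zero fun i _ => ?_
    rcases (hB i).eq_or_lt with h0 | hpos
    · rw [← h0, zero_mul]
    · have h1 : partialP i w = fun _ => 0 := funext (hA i hpos)
      rw [h1]
      simp
  have hX : ∀ z, fderiv ℝ w z (hamField (pinnedChain ω₂ lam β γ) L z) = 0 := by
    intro z
    have h := hpde z
    rw [hbath z, mul_zero, add_zero] at h
    rw [← liouvilleOp_eq_fderiv (pinnedChain ω₂ lam β γ) (hU.differentiable (by simp))
      (hV.differentiable (by simp)) hwd]
    exact (mul_eq_zero.mp h).resolve_left hσ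
  have h0 : ∀ z, fderiv ℝ w z (unitP ⟨0, hL⟩) = 0 := by
    intro z
    have h := hA ⟨0, hL⟩ hB0 z
    rw [partialP_eq_fderiv hwd] at h
    simpa [unitP_eq] using h
  have hV2 : ∀ r, deriv (deriv (pinnedChain ω₂ lam β γ).V) r ≠ 0 := fun r => by
    rw [pinnedChain_deriv_deriv_V]
    positivity
  have hD : ∀ z, fderiv ℝ w z = 0 :=
    fderiv_eq_zero_of_liouville hU hV hV2 hL hw hX h0
  exact is_const_of_fderiv_eq_zero hwd hD x y

/-- The mean-zero version: such a `w` with `∫ w dμ_T = 0` vanishes identically. [folklore] -/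
theorem eq_zero_of_liouville_pinnedChain (hω : 0 < ω₂) (hl : 0 ≤ lam) (hβ : 0 ≤ β) (γ : ℝ)
    {L : ℕ} (hL : 0 < L) {T : ℝ} (hT : 0 < T) (B : Fin L → ℝ) (hB : ∀ i, 0 ≤ B i)
    (hB0 : 0 < B ⟨0, hL⟩) {σ : ℝ} (hσ : σ ≠ 0) {c : ℝ} (hc : 0 < c) {w : PhaseSpace L → ℝ}
    (hw : ContDiff ℝ 2 w) (hw2 : MemLp w 2 ((pinnedChain ω₂ lam β γ).gibbsMeasure L T))
    (hpde : ∀ x, σ * liouvilleOp (pinnedChain ω₂ lam β γ) L w x + c * bathOp L B T w x = 0)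
    (hmean : ∫ x, w x ∂((pinnedChain ω₂ lam β γ).gibbsMeasure L T) = 0) (x : PhaseSpace L) :
    w x = 0 := by
  have hconst := liouville_pinnedChain hω hl hβ γ hL hT B hB hB0 hσ hc hw hw2 hpde
  have hw_eq : w = fun _ => w x := funext fun y => hconst y x
  haveI := pinnedChain_isProbabilityMeasure_gibbsMeasure hω hl hβ γ L hT
  rw [hw_eq, integral_const] at hmean
  simpa using hmean

variable (P : OscillatorChain)

/-- Site weights of the device's four thermostats: `[i=0] + [i=L−1] + [i=N−1] + [i=N]`. [folklore] -/
def deviceWeight (N M : ℕ) (i : Fin (N + M)) : ℝ :=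
  OscillatorChain.bathWeight (N + M) i + ((if i.val = N - 1 then 1 else 0) + (if i.val = N then 1 else 0))

/-- At equal terminal temperatures the device generator is `X_H + γ S_B` with `B = deviceWeight`. [folklore] -/
theorem deviceGenerator_eq (N M : ℕ) (T : ℝ) (f : PhaseSpace (N + M) → ℝ) (x : PhaseSpace (N + M)) :
    deviceGenerator P N M (fun _ => T) f x =
      liouvilleOp P (N + M) f x + P.γ * bathOp (N + M) (deviceWeight N M) T f x := by
  simp only [deviceGenerator, OscillatorChain.generator, liouvilleOp, bathOp, thermo, deviceWeight,
    OscillatorChain.bathWeight]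
  rw [add_assoc, ← mul_add, ← Finset.sum_add_distrib, ← Finset.sum_add_distrib]
  congr 1
  congr 1
  refine Finset.sum_congr rfl fun i _ => ?_
  split_ifs <;> ring

variable {P}

/-- `X_H` is linear (subtraction). [folklore] -/
theorem liouvilleOp_sub {L : ℕ} {f g : PhaseSpace L → ℝ} (hf : Differentiable ℝ f)
    (hg : Differentiable ℝ g) (x : PhaseSpace L) :
    liouvilleOp P L (fun y => f y - g y) x = liouvilleOp P L f x - liouvilleOp P L g x := by
  unfold liouvilleOp
  rw [← Finset.sum_sub_distrib]
  refine Finset.sum_congr rfl fun i _ => ?_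
  rw [partialQ_sub hf hg, partialP_sub hf hg]
  ring

/-- `S_B` is linear (subtraction) on `C²`. [folklore] -/
theorem bathOp_sub {L : ℕ} {f g : PhaseSpace L → ℝ} (hf : ContDiff ℝ 2 f) (hg : ContDiff ℝ 2 g)
    (B : Fin L → ℝ) (T : ℝ) (x : PhaseSpace L) :
    bathOp L B T (fun y => f y - g y) x = bathOp L B T f x - bathOp L B T g x := by
  have hfd := hf.differentiable two_ne_zero
  have hgd := hg.differentiable two_ne_zero
  unfold bathOp
  rw [← Finset.sum_sub_distrib]
  refine Finset.sum_congr rfl fun i _ => ?_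
  have h1 : partialP i (fun y => f y - g y) = fun y => partialP i f y - partialP i g y :=
    funext fun y => partialP_sub hfd hgd i y
  rw [h1, partialP_sub (differentiable_partialP_of_contDiff_two hf i)
    (differentiable_partialP_of_contDiff_two hg i)]
  ring

/-- **Uniqueness of forward fields (DeviceFrame, clauses `gb = gb₁` / `gb = gb₄`).** For the pinned
chain with `ω₂ > 0`, `lam, β ≥ 0`, `γ > 0`, `T > 0` and any split with `N + M ≥ 1`: two `C²`,
`L²(μ_T)`, mean-zero classical solutions of `L_dev g = −(p_s² − T)` (all four terminals at `T`)
coincide everywhere — their difference is a mean-zero `C² ∩ L²(μ_T)` solution of `L_dev w = 0`,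
hence `0` by the Liouville theorem. No semigroup, no hypoellipticity and no growth condition on
`∇g` is used. The hypotheses are exactly the clauses of the line's `IsForwardField` (minus the
unused `S_K gb ∈ L²`), so `∀ gb, IsForwardField P T N M s gb → gb = gb₁` follows by `obtain`.
[folklore] -/
theorem forwardField_unique (hω : 0 < ω₂) (hl : 0 ≤ lam) (hβ : 0 ≤ β) {γ : ℝ} (hγ : 0 < γ)
    {T : ℝ} (hT : 0 < T) {N M : ℕ} (hNM : 0 < N + M) (s : ℕ)
    {gb gb' : PhaseSpace (N + M) → ℝ}
    (hC : ContDiff ℝ 2 gb) (hL2 : MemLp gb 2 ((pinnedChain ω₂ lam β γ).gibbsMeasure (N + M) T))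
    (hmean : ∫ x, gb x ∂((pinnedChain ω₂ lam β γ).gibbsMeasure (N + M) T) = 0)
    (hpde : ∀ x, deviceGenerator (pinnedChain ω₂ lam β γ) N M (fun _ => T) gb x =
      -(kin (N + M) s x - T))
    (hC' : ContDiff ℝ 2 gb') (hL2' : MemLp gb' 2 ((pinnedChain ω₂ lam β γ).gibbsMeasure (N + M) T))
    (hmean' : ∫ x, gb' x ∂((pinnedChain ω₂ lam β γ).gibbsMeasure (N + M) T) = 0)
    (hpde' : ∀ x, deviceGenerator (pinnedChain ω₂ lam β γ) N M (fun _ => T) gb' x =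
      -(kin (N + M) s x - T)) :
    gb = gb' := by
  have hwC : ContDiff ℝ 2 (fun y => gb y - gb' y) := hC.sub hC'
  have hwL2 : MemLp (fun y => gb y - gb' y) 2 ((pinnedChain ω₂ lam β γ).gibbsMeasure (N + M) T) :=
    hL2.sub hL2'
  haveI := pinnedChain_isProbabilityMeasure_gibbsMeasure hω hl hβ γ (N + M) hT
  have hwmean : ∫ x, (fun y => gb y - gb' y) x ∂((pinnedChain ω₂ lam β γ).gibbsMeasure (N + M) T) = 0 := by
    simp only
    rw [integral_sub (hL2.integrable one_le_two) (hL2'.integrable one_le_two), hmean, hmean', sub_zero]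
  have hwpde : ∀ x, 1 * liouvilleOp (pinnedChain ω₂ lam β γ) (N + M) (fun y => gb y - gb' y) x +
      γ * bathOp (N + M) (deviceWeight N M) T (fun y => gb y - gb' y) x = 0 := by
    intro x
    have e := hpde x
    have e' := hpde' x
    rw [deviceGenerator_eq] at e e'
    rw [one_mul, liouvilleOp_sub (hC.differentiable two_ne_zero) (hC'.differentiable two_ne_zero),
      bathOp_sub hC hC']
    have hγ' : (pinnedChain ω₂ lam β γ).γ = γ := rfl
    rw [hγ'] at e e'
    linear_combination e - e'
  have hB : ∀ i, 0 ≤ deviceWeight N M i := fun i => by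
    unfold deviceWeight OscillatorChain.bathWeight
    split_ifs <;> norm_num
  have hB0 : 0 < deviceWeight N M ⟨0, hNM⟩ := by
    unfold deviceWeight OscillatorChain.bathWeight
    simp only [if_true]
    split_ifs <;> norm_num
  have hzero := eq_zero_of_liouville_pinnedChain hω hl hβ γ hNM hT (deviceWeight N M) hB hB0
    one_ne_zero hγ hwC hwL2 hwpde hwmean
  funext y
  exact sub_eq_zero.mp (hzero y)

end Liouville

/-- Registered helper sub-goal `helper_forwardFieldUnique` (= `forwardField_unique` in stub form):
uniqueness of the device's forward fields (DeviceFrame clauses `gb = gb₁`, `gb = gb₄`). [folklore] -/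
theorem helper_forwardFieldUnique : ∀ (ω₂ lam β γ : ℝ), 0 < ω₂ → 0 ≤ lam → 0 ≤ β → 0 < γ → ∀ (T : ℝ), 0 < T → ∀ (N M : ℕ), 0 < N + M → ∀ (s : ℕ) (gb gb' : PhaseSpace (N + M) → ℝ), ContDiff ℝ 2 gb → MemLp gb 2 ((pinnedChain ω₂ lam β γ).gibbsMeasure (N + M) T) → ∫ x, gb x ∂((pinnedChain ω₂ lam β γ).gibbsMeasure (N + M) T) = 0 → (∀ x, deviceGenerator (pinnedChain ω₂ lam β γ) N M (fun _ => T) gb x = -(kin (N + M) s x - T)) → ContDiff ℝ 2 gb' → MemLp gb' 2 ((pinnedChain ω₂ lam β γ).gibbsMeasure (N + M) T) → ∫ x, gb' x ∂((pinnedChain ω₂ lam β γ).gibbsMeasure (N + M) T) = 0 → (∀ x, deviceGenerator (pinnedChain ω₂ lam β γ) N M (fun _ => T) gb' x = -(kin (N + M) s x - T)) → gb = gb' :=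
  fun _ _ _ _ hω hl hβ hγ _ hT _ _ hNM s _ _ hC hL2 hmean hpde hC' hL2' hmean' hpde' =>
    forwardField_unique hω hl hβ hγ hT hNM s hC hL2 hmean hpde hC' hL2' hmean' hpde'

end Summit.AtomisticToContinuum.FouriersLaw.Theorems.SuperadditiveResistance.DeviceLiouville

end
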